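import Summits.Ventures.HSemireg.WedgeHankelRecurrenceGaussSchurResultant

/-!
# Venture HSemireg — **THE SCHUR–STIELTJES DISCRIMINANT LEMMA**: if a polynomial `f` of (formal) degree `m+1` and leading coefficient `ℓ` satisfies a LOWERING RELATION
# `π · f′ = A · f + c · g` (`deg π ≤ d`, `deg A ≤ d − 1`, `deg g ≤ m`), then **`Res_{(m+1,d)}(f, π) · Res_{(m+1,m)}(f, f′) = c^{m+1} ℓ^d · Res_{(m+1,m)}(f, g)`**, hence
# **`(−1)^{m(m+1)∕2} ℓ · Res(f, π) · disc f = c^{m+1} ℓ^d · Res(f, g)`** (Mathlib's `Polynomial.discr`); for the three-term recurrence of N403 and `g = q_n`, `f = q_{n+1}` SCHUR's theorem turns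
# this into **`Res_{(n+1,d)}(q_{n+1}, π) · disc(q_{n+1}) = c^{n+1} ∏_{k=1}^{n} b_k^k`**, and in the APPELL case `q_{n+1}′ = c · q_n` into **`disc(q_{n+1}) = c^{n+1} ∏_{k=1}^{n} b_k^k`**

HONEST FRAMING. Part of the Lean index of the computation cell `pub-hsemireg` (seat p10 gen 47, Sunday typer «UNIFORM-IN-n»).  Polynomial algebra over a commutative ring only (Mathlib
`Polynomial.resultant`, `Polynomial.discr`); no variety, no cohomology theory, no sheaf, no Ext group and no semiregularity map is constructed here; nothing here says that HC / HC_CM / HC_AV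
holds; no Literature fact (unproved `Prop`) is declared or used.  Custodian versions as in `WedgeHankelSiegelIdeal` (1/3).
SOURCES (cited).  T. J. Stieltjes, *Sur quelques théorèmes d'algèbre*, C. R. Acad. Sci. Paris 100 (1885) 439–440 and *Sur les polynômes de Jacobi*, ibid. 620–622 (discriminants of the
classical polynomials); D. Hilbert, *Über die Discriminante der im Endlichen abbrechenden hypergeometrischen Reihe*, J. reine angew. Math. 103 (1888) 337–345; I. Schur, J. reine angew. Math.
165 (1931) 52–58, §1–§2 (the method: `Res(f, f′)` from a lowering relation and the resultant of consecutive terms); G. Szegő, *Orthogonal Polynomials*, §6.71, eqs. (6.71.1)–(6.71.4);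
M. E. H. Ismail, *Classical and Quantum Orthogonal Polynomials* (2005), §3.4, Lemma 3.4.1–Thm 3.4.2 («Schur's lemma» for `A_n(x) p_n′ = …`).
PROOF TYPED HERE.  `Res_{(m+1,d+m)}(f, π f′)` two ways: multiplicativity (`resultant_mul_right`, formal degrees adjusted by `resultant_add_right_deg`, which costs powers of `ℓ = [X^{m+1}] f`) and
`π f′ = c g + f·A` (`resultant_add_mul_right`, `resultant_C_mul_right`); then Mathlib `resultant_deriv` (`Res(f, f′) = (−1)^{m(m+1)∕2} ℓ disc f`) and N403 `schur_resultant_sign`; the two signs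
`(−1)^{n(n+1)∕2}` cancel.
DEDUP DISCLOSURE (`rg -n -i 'discr_eq|resultant_derivative|lowering' Summits/Ventures/HSemireg Literature`, 2026-09-04): N160 ∕ N161 (signs of `disc` ∕ `Res` over `ℝ`), N653-block `det_hankelSq_dualSeq_derivative`
(`disc` as a Hankel determinant), `discr_prod_X_sub_C`; no lowering-relation lemma; 0 hits for the 6 names below.

WHAT IS IN THE TREE.  N403 `recurrence_natDegree_le_coeff`, `schur_resultant_sign`; Mathlib `resultant_mul_right`, `resultant_add_right_deg`, `resultant_add_mul_right`, `resultant_C_mul_right`,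
`resultant_deriv`, `natDegree_derivative_le`.
THIS FILE (namespace `Summit.Ventures.HSemireg.Wedge.HankelOuter` continued; CHAINED on N403; 0 definitions):
* §1169 **`resultant_mul_resultant_derivative_eq`** (the lemma, any commutative ring, any leading coefficient), **`resultant_mul_discr_eq`** (`(−1)^{m(m+1)∕2} ℓ Res(f,π) disc f = c^{m+1} ℓ^d Res(f,g)`
  when `deg f = m + 1`), `discr_eq_of_derivative_eq` (Appell case `f′ = c g`: `(−1)^{m(m+1)∕2} ℓ disc f = c^{m+1} Res(f,g)`), `recurrence_natDegree_leadingCoeff` (nontrivial ring: `deg q_n = n`,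
  `lc = 1`), **`resultant_mul_discr_recurrence`** (`Res_{(n+1,d)}(q_{n+1}, π) disc q_{n+1} = c^{n+1} ∏ b_k^k`), **`discr_recurrence_of_derivative_eq`** (`q_{n+1}′ = c q_n ⇒ disc q_{n+1} = c^{n+1} ∏ b_k^k`).
CAVEATS.  `hA : deg A + 1 ≤ d` forces `d ≥ 1` in the general lemma (the `π = 1` Appell case is the separate lemma); the recurrence versions need a nontrivial ring (so that `deg q_{n+1} = n + 1`
literally, as `resultant_deriv` is stated at `f.natDegree`).  Nothing Ext-side.  New names only.
-/

open Module Polynomial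
open scoped Matrix Polynomial

namespace Summit.Ventures.HSemireg.Wedge.HankelOuter

/-! ## §1169. The Schur–Stieltjes discriminant lemma -/

/-- **THE LOWERING-RELATION LEMMA: `π f′ = A f + c g` (`deg f ≤ m+1`, `deg π ≤ d`, `deg A + 1 ≤ d`, `deg g ≤ m`) ⇒
`Res_{(m+1,d)}(f, π) · Res_{(m+1,m)}(f, f′) = c^{m+1} · ([X^{m+1}] f)^d · Res_{(m+1,m)}(f, g)`** over any commutative ring. [Schur 1931 §1–2; Szegő §6.71; Ismail Lemma 3.4.1; this file, §1169] -/
theorem resultant_mul_resultant_derivative_eq {R : Type*} [CommRing R] {f π A g : R[X]} {c : R} {m d : ℕ}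
    (hf : f.natDegree ≤ m + 1) (hπ : π.natDegree ≤ d) (hA : A.natDegree + 1 ≤ d) (hg : g.natDegree ≤ m) (h : π * derivative f = A * f + C c * g) :
    f.resultant π (m + 1) d * f.resultant (derivative f) (m + 1) m = c ^ (m + 1) * f.coeff (m + 1) ^ d * f.resultant g (m + 1) m := by
  have hf' : (derivative f).natDegree ≤ m := (natDegree_derivative_le f).trans (by omega)
  -- (1) multiplicativity at the true degrees, lifted to any larger formal degrees
  have hmul := resultant_mul_right f π (derivative f) (m + 1) hf
  have gen : ∀ n₁ n₂ : ℕ, π.natDegree ≤ n₁ → (derivative f).natDegree ≤ n₂ →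
      f.resultant (π * derivative f) (m + 1) (n₁ + n₂) = f.resultant π (m + 1) n₁ * f.resultant (derivative f) (m + 1) n₂ := by
    intro n₁ n₂ h₁ h₂
    obtain ⟨i, rfl⟩ := Nat.exists_eq_add_of_le h₁
    obtain ⟨j, rfl⟩ := Nat.exists_eq_add_of_le h₂
    rw [show π.natDegree + i + ((derivative f).natDegree + j) = (π.natDegree + (derivative f).natDegree) + (i + j) by ring,
      resultant_add_right_deg f (π * derivative f) (m + 1) (π.natDegree + (derivative f).natDegree) (i + j) natDegree_mul_le, hmul,
      resultant_add_right_deg f π (m + 1) π.natDegree i le_rfl, resultant_add_right_deg f (derivative f) (m + 1) (derivative f).natDegree j le_rfl]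
    ring
  have e1 : f.resultant (π * derivative f) (m + 1) (d + m) = f.resultant π (m + 1) d * f.resultant (derivative f) (m + 1) m := gen d m hπ hf'
  -- (2) the lowering relation
  have e2 : f.resultant (π * derivative f) (m + 1) (d + m) = c ^ (m + 1) * f.coeff (m + 1) ^ d * f.resultant g (m + 1) m := by
    rw [h, show A * f + C c * g = C c * g + f * A by ring, resultant_add_mul_right f (C c * g) A (m + 1) (d + m) (by omega) hf, resultant_C_mul_right, add_comm d m,
      resultant_add_right_deg f g (m + 1) m d hg]
    ring
  rw [← e1, e2]

/-- **THE SCHUR–STIELTJES LEMMA WITH THE DISCRIMINANT: `deg f = m + 1`, `π f′ = A f + c g` ⇒ `(−1)^{(m+1)m∕2} ℓ · Res_{(m+1,d)}(f, π) · disc f = c^{m+1} ℓ^d · Res_{(m+1,m)}(f, g)`**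
(`ℓ` the leading coefficient; Mathlib `Polynomial.discr`). [Stieltjes 1885; Hilbert 1888; Schur 1931 §2; Szegő (6.71.1)–(6.71.4); this file, §1169] -/
theorem resultant_mul_discr_eq {R : Type*} [CommRing R] {f π A g : R[X]} {c : R} {m d : ℕ}
    (hfd : f.natDegree = m + 1) (hπ : π.natDegree ≤ d) (hA : A.natDegree + 1 ≤ d) (hg : g.natDegree ≤ m) (h : π * derivative f = A * f + C c * g) :
    (-1) ^ ((m + 1) * m / 2) * f.leadingCoeff * (f.resultant π (m + 1) d * f.discr) = c ^ (m + 1) * f.leadingCoeff ^ d * f.resultant g (m + 1) m := by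
  have hdeg : 0 < f.degree := natDegree_pos_iff_degree_pos.mp (by omega)
  have key := resultant_deriv hdeg
  rw [hfd, Nat.add_sub_cancel] at key
  have e := resultant_mul_resultant_derivative_eq hfd.le hπ hA hg h
  rw [key, show f.coeff (m + 1) = f.leadingCoeff by rw [leadingCoeff, hfd]] at e
  linear_combination e

/-- **THE APPELL CASE `f′ = c · g`: `(−1)^{(m+1)m∕2} ℓ · disc f = c^{m+1} · Res_{(m+1,m)}(f, g)`** (`deg f = m + 1`). [Hilbert 1888 (Hermite); Schur 1931 §2; Szegő (6.71.3); this file, §1169] -/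
theorem discr_eq_of_derivative_eq {R : Type*} [CommRing R] {f g : R[X]} {c : R} {m : ℕ} (hfd : f.natDegree = m + 1) (h : derivative f = C c * g) :
    (-1) ^ ((m + 1) * m / 2) * f.leadingCoeff * f.discr = c ^ (m + 1) * f.resultant g (m + 1) m := by
  have hdeg : 0 < f.degree := natDegree_pos_iff_degree_pos.mp (by omega)
  have key := resultant_deriv hdeg
  rw [hfd, Nat.add_sub_cancel, h, resultant_C_mul_right] at key
  linear_combination (-1 : R) * key

/-- Over a NONTRIVIAL commutative ring the recurrence polynomials have `deg q_n = n` and leading coefficient `1`. [this file, §1169] -/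
theorem recurrence_natDegree_leadingCoeff {R : Type*} [CommRing R] [Nontrivial R] {q : ℕ → R[X]} {a b : ℕ → R} (hq0 : q 0 = 1) (hq1 : q 1 = Polynomial.X - C (a 0))
    (hrec : ∀ n, q (n + 2) = (Polynomial.X - C (a (n + 1))) * q (n + 1) - C (b (n + 1)) * q n) (n : ℕ) :
    (q n).natDegree = n ∧ (q n).leadingCoeff = 1 := by
  obtain ⟨hd, hc⟩ := recurrence_natDegree_le_coeff hq0 hq1 hrec n
  have hdeq : (q n).natDegree = n := le_antisymm hd (le_natDegree_of_ne_zero (by rw [hc]; exact one_ne_zero))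
  exact ⟨hdeq, by rw [leadingCoeff, hdeq, hc]⟩

/-- **SCHUR'S METHOD FOR THE RECURRENCE: `π q_{n+1}′ = A q_{n+1} + c q_n` (`deg π ≤ d`, `deg A + 1 ≤ d`) ⇒ `Res_{(n+1,d)}(q_{n+1}, π) · disc(q_{n+1}) = c^{n+1} ∏_{k<n} b_{k+1}^{k+1}`**
(nontrivial commutative ring; the two signs `(−1)^{n(n+1)∕2}` of `resultant_deriv` and of N403 cancel). [Schur 1931 §2; Szegő (6.71.1)–(6.71.4); Ismail Thm 3.4.2; this file, §1169] -/
theorem resultant_mul_discr_recurrence {R : Type*} [CommRing R] [Nontrivial R] {q : ℕ → R[X]} {a b : ℕ → R} (hq0 : q 0 = 1) (hq1 : q 1 = Polynomial.X - C (a 0))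
    (hrec : ∀ n, q (n + 2) = (Polynomial.X - C (a (n + 1))) * q (n + 1) - C (b (n + 1)) * q n) {π A : R[X]} {c : R} {d n : ℕ}
    (hπ : π.natDegree ≤ d) (hA : A.natDegree + 1 ≤ d) (h : π * derivative (q (n + 1)) = A * q (n + 1) + C c * q n) :
    (q (n + 1)).resultant π (n + 1) d * (q (n + 1)).discr = c ^ (n + 1) * ∏ k ∈ Finset.range n, b (k + 1) ^ (k + 1) := by
  obtain ⟨hdn, -⟩ := recurrence_natDegree_le_coeff hq0 hq1 hrec n
  obtain ⟨hd1, hl1⟩ := recurrence_natDegree_leadingCoeff hq0 hq1 hrec (n + 1)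
  have e := resultant_mul_discr_eq hd1 hπ hA hdn h
  rw [hl1, schur_resultant_sign hq0 hq1 hrec n, show (n + 1) * n / 2 = n * (n + 1) / 2 by rw [mul_comm]] at e
  have hsq : ((-1 : R) ^ (n * (n + 1) / 2)) * ((-1 : R) ^ (n * (n + 1) / 2)) = 1 := by rw [← pow_add, ← two_mul, pow_mul, neg_one_sq, one_pow]
  linear_combination ((-1 : R) ^ (n * (n + 1) / 2)) * e -
    ((q (n + 1)).resultant π (n + 1) d * (q (n + 1)).discr - c ^ (n + 1) * ∏ k ∈ Finset.range n, b (k + 1) ^ (k + 1)) * hsq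

/-- **THE APPELL CASE FOR THE RECURRENCE: `q_{n+1}′ = c · q_n` ⇒ `disc(q_{n+1}) = c^{n+1} ∏_{k<n} b_{k+1}^{k+1}`** (nontrivial commutative ring). [Hilbert 1888; Schur 1931 §2; Szegő (6.71.3);
this file, §1169] -/
theorem discr_recurrence_of_derivative_eq {R : Type*} [CommRing R] [Nontrivial R] {q : ℕ → R[X]} {a b : ℕ → R} (hq0 : q 0 = 1) (hq1 : q 1 = Polynomial.X - C (a 0))
    (hrec : ∀ n, q (n + 2) = (Polynomial.X - C (a (n + 1))) * q (n + 1) - C (b (n + 1)) * q n) {c : R} {n : ℕ} (h : derivative (q (n + 1)) = C c * q n) :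
    (q (n + 1)).discr = c ^ (n + 1) * ∏ k ∈ Finset.range n, b (k + 1) ^ (k + 1) := by
  obtain ⟨hd1, hl1⟩ := recurrence_natDegree_leadingCoeff hq0 hq1 hrec (n + 1)
  have e := discr_eq_of_derivative_eq hd1 h
  rw [hl1, schur_resultant_sign hq0 hq1 hrec n, show (n + 1) * n / 2 = n * (n + 1) / 2 by rw [mul_comm], mul_one] at e
  have hsq : ((-1 : R) ^ (n * (n + 1) / 2)) * ((-1 : R) ^ (n * (n + 1) / 2)) = 1 := by rw [← pow_add, ← two_mul, pow_mul, neg_one_sq, one_pow]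
  linear_combination ((-1 : R) ^ (n * (n + 1) / 2)) * e - ((q (n + 1)).discr - c ^ (n + 1) * ∏ k ∈ Finset.range n, b (k + 1) ^ (k + 1)) * hsq

end Summit.Ventures.HSemireg.Wedge.HankelOuter
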